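import Mathlib
import Summits.KontsevichZagierPeriods.Zeta5Search.CatalanQSumTwoAdicProof
import HarnessLib

/-!
# Beukers' approximants at `x = ½`: the denominator of `q_n(½)` is exactly `2^{4n − 2 s₂(n)}`

Kernel form of the `q`-half of §T, Consequences (b) (fam-catalan g5, kernel K5g; previously OBSERVED
for `n ≤ 400` in exact arithmetic).  HONEST FRAMING: systematic search; no irrationality claim unless
certified — this file is a statement about denominators only.

Beukers [Be08, §6, after Prop. 11 and in the proof of Prop. 12] approximates `Θ(x)` by `p_n(x)/q_n(x)`
with
`q_n(x) = ∑_{k=0}^{n} (1−x)_{n−k} (x)_k² / ((n−k)! (k!)²)`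
(the Taylor coefficients of `y₀(z) = (1−z)^{x−1} ₂F₁(x,x;1;z)`; `(x)_k` the rising factorial), and
Bel's lemma applied to `p_n(½), q_n(½)` gives the `2`-adic irrationality measure of
`Θ₂(½) = −8ζ₂(2)` whose exponent `7.1774…` (C4) reproduces.  Here `beukersQ x n` is that sum
verbatim (`CatalanQSum.poch` = Mathlib's `ascPochhammer`, `CatalanQSum.poch_eq`), and we prove

* `padicValRat_beukersQ_half : v₂(q_n(½)) = −4n + 2 s₂(n)` (`s₂` = binary digit sum), and
* `den_beukersQ_half : den q_n(½) = 2^{4n − 2 s₂(n)}` — no odd prime, exact power of two.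

Proof: at `x = ½` the `k`-th term is `((½)_{n−k}/(n−k)!)·((½)_k/k!)²` with
`v₂((½)_m/m!) = −2m + s₂(m)` (`v₂((½)_m) = −m`, Legendre `v₂(m!) = m − s₂(m)`), so
`v₂(term_k) = −2n − 2k + s₂(n−k) + 2s₂(k)`; the `k = n` term has valuation `−4n + 2s₂(n)` and is the
UNIQUE minimum because `s₂(n) ≤ s₂(k) + s₂(n−k)` (Kummer: `= s₂(n) + v₂(C(n,k))`) and `s₂(m) < 2m`
for `m ≥ 1`; all terms are positive, so the ultrametric inequality is an equality
(`padicValRat.lt_sum_of_lt`, `padicValRat.add_eq_of_lt`).  For the denominator, `(½)_m·4^m = m!·C(2m,m)`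
exhibits `q_n(½) = A/4^{2n}` with `A ∈ ℕ`, so `den ∣ 2^{4n}` is a power of two, fixed by the valuation.
-/

open Finset

namespace Summit.KontsevichZagierPeriods.Zeta5Search.CatalanBeukersDenominator

open CatalanQSum (poch poch_eq poch_oneHalf_ne_zero padicValRat_poch_oneHalf padicValNat_two_factorial
  padicValNat_factorial_eq_choose)

/-- Binary digit sum `s₂(n)`. -/
def sTwo (n : ℕ) : ℕ := (Nat.digits 2 n).sum

/-- Beukers' `q_n(x) = ∑_{k=0}^{n} (1−x)_{n−k} (x)_k² / ((n−k)! (k!)²)` [Be08, proof of Prop. 12]. -/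
def beukersQ (x : ℚ) (n : ℕ) : ℚ :=
  ∑ k ∈ range (n + 1), poch (1 - x) (n - k) * poch x k ^ 2 / (((n - k).factorial : ℚ) * (k.factorial : ℚ) ^ 2)

/-- The `k`-th term of `q_n(½)`. -/
def termHalf (n k : ℕ) : ℚ :=
  poch (1 / 2) (n - k) * poch (1 / 2) k ^ 2 / (((n - k).factorial : ℚ) * (k.factorial : ℚ) ^ 2)

/-- `q_n(½) = ∑_k termHalf n k` (since `1 − ½ = ½`). -/
theorem beukersQ_half (n : ℕ) : beukersQ (1 / 2) n = ∑ k ∈ range (n + 1), termHalf n k := by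
  unfold beukersQ termHalf; norm_num

/-- Sanity: `q_1(½) = 3/4`, `q_2(½) = 41/64`, `q_3(½) = 147/256`. -/
example : beukersQ (1 / 2) 1 = 3 / 4 ∧ beukersQ (1 / 2) 2 = 41 / 64 ∧ beukersQ (1 / 2) 3 = 147 / 256 := by
  refine ⟨?_, ?_, ?_⟩ <;> norm_num [beukersQ, sum_range_succ, poch]

/-- `(½)_m > 0`. -/
theorem poch_oneHalf_pos (m : ℕ) : 0 < poch (1 / 2) m := by
  induction m with
  | zero => simp [poch]
  | succ m ih => rw [poch]; positivity

/-- Every term of `q_n(½)` is positive. -/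
theorem termHalf_pos (n k : ℕ) : 0 < termHalf n k := by
  unfold termHalf
  have := poch_oneHalf_pos (n - k); have := poch_oneHalf_pos k
  positivity

/-- `v₂((½)_m / m!) = −2m + s₂(m)`. -/
theorem padicValRat_poch_div_factorial (m : ℕ) :
    padicValRat 2 (poch (1 / 2) m / (m.factorial : ℚ)) = -(2 * m : ℤ) + sTwo m := by
  rw [padicValRat.div (poch_oneHalf_ne_zero m) (by positivity), padicValRat_poch_oneHalf,
    padicValRat.of_nat]
  have := padicValNat_two_factorial m
  unfold sTwo; omega

/-- `v₂(termHalf n k) = −2n − 2k + s₂(n−k) + 2 s₂(k)` for `k ≤ n`. -/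
theorem padicValRat_termHalf (n k : ℕ) (hk : k ≤ n) :
    padicValRat 2 (termHalf n k) = -(2 * n : ℤ) - 2 * k + sTwo (n - k) + 2 * sTwo k := by
  have h : termHalf n k =
      (poch (1 / 2) (n - k) / ((n - k).factorial : ℚ)) * (poch (1 / 2) k / (k.factorial : ℚ)) ^ 2 := by
    unfold termHalf; field_simp
  have h1 : poch (1 / 2) (n - k) / ((n - k).factorial : ℚ) ≠ 0 :=
    div_ne_zero (poch_oneHalf_ne_zero _) (by positivity)
  have h2 : poch (1 / 2) k / (k.factorial : ℚ) ≠ 0 := div_ne_zero (poch_oneHalf_ne_zero _) (by positivity)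
  rw [h, padicValRat.mul h1 (pow_ne_zero _ h2), padicValRat.pow, padicValRat_poch_div_factorial,
    padicValRat_poch_div_factorial]
  push_cast [Nat.cast_sub hk]
  ring

/-- Digit-sum subadditivity (Kummer): `s₂(n) ≤ s₂(k) + s₂(n−k)` for `k ≤ n`
(indeed `s₂(k) + s₂(n−k) − s₂(n) = v₂(C(n,k)) ≥ 0`, by Legendre). -/
theorem sTwo_le_add (n k : ℕ) (hk : k ≤ n) : sTwo n ≤ sTwo k + sTwo (n - k) := by
  have h := padicValNat_factorial_eq_choose n k hk
  have h1 := padicValNat_two_factorial n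
  have h2 := padicValNat_two_factorial k
  have h3 := padicValNat_two_factorial (n - k)
  unfold sTwo
  omega

/-- `s₂(m) ≤ m`. -/
theorem sTwo_le (m : ℕ) : sTwo m ≤ m := Nat.digit_sum_le 2 m

/-- Strict domination: for `k < n` the last term has strictly smaller valuation than the `k`-th. -/
theorem padicValRat_termHalf_lt (n k : ℕ) (hk : k < n) :
    padicValRat 2 (termHalf n n) < padicValRat 2 (termHalf n k) := by
  rw [padicValRat_termHalf n n le_rfl, padicValRat_termHalf n k hk.le, Nat.sub_self]
  have h1 := sTwo_le_add n k hk.le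
  have h2 := sTwo_le (n - k)
  have h3 : sTwo 0 = 0 := by simp [sTwo]
  rw [h3]
  zify [hk.le] at h1 h2
  push_cast
  omega

/-- **`v₂(q_n(½)) = −4n + 2 s₂(n)`.** -/
theorem padicValRat_beukersQ_half (n : ℕ) :
    padicValRat 2 (beukersQ (1 / 2) n) = -(4 * n : ℤ) + 2 * sTwo n := by
  rw [beukersQ_half]
  rcases Nat.eq_zero_or_pos n with rfl | hn
  · simp [termHalf, poch, sTwo]
  have hne : (range n).Nonempty := nonempty_range_iff.mpr hn.ne'
  have hlt : padicValRat 2 (termHalf n n) < padicValRat 2 (∑ k ∈ range n, termHalf n k) :=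
    padicValRat.lt_sum_of_lt hne (fun i hi => padicValRat_termHalf_lt n i (mem_range.mp hi))
      (termHalf_pos n)
  have hpos : 0 < ∑ k ∈ range n, termHalf n k := sum_pos (fun i _ => termHalf_pos n i) hne
  rw [sum_range_succ, add_comm,
    padicValRat.add_eq_of_lt (by have := termHalf_pos n n; positivity) (termHalf_pos n n).ne' hpos.ne' hlt,
    padicValRat_termHalf n n le_rfl, Nat.sub_self]
  simp [sTwo]
  ring

/-- `(½)_m · 4^m = m! · C(2m, m)` (i.e. `(½)_m = (2m)!/(4^m m!)`). -/
theorem poch_half_mul_four_pow (m : ℕ) :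
    poch (1 / 2) m * 4 ^ m = (m.factorial : ℚ) * (m.centralBinom : ℚ) := by
  induction m with
  | zero => simp [poch]
  | succ m ih =>
    have hrec : ((m : ℚ) + 1) * ((m + 1).centralBinom : ℚ) = 2 * (2 * (m : ℚ) + 1) * (m.centralBinom : ℚ) := by
      have := Nat.succ_mul_centralBinom_succ m
      exact_mod_cast this
    calc poch (1 / 2) (m + 1) * 4 ^ (m + 1)
        = (poch (1 / 2) m * 4 ^ m) * (2 * (2 * (m : ℚ) + 1)) := by rw [poch]; ring
      _ = (m.factorial : ℚ) * (((m : ℚ) + 1) * ((m + 1).centralBinom : ℚ)) := by rw [ih, hrec]; ring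
      _ = ((m + 1).factorial : ℚ) * ((m + 1).centralBinom : ℚ) := by push_cast [Nat.factorial_succ]; ring

/-- The `k`-th term in closed form: `C(2(n−k), n−k) · C(2k, k)² · 4^{n−k} / 4^{2n}`. -/
theorem termHalf_eq (n k : ℕ) (hk : k ≤ n) :
    termHalf n k = ((n - k).centralBinom : ℚ) * (k.centralBinom : ℚ) ^ 2 * 4 ^ (n - k) / 4 ^ (2 * n) := by
  have h1 := poch_half_mul_four_pow (n - k)
  have h2 := poch_half_mul_four_pow k
  have e : (4 : ℚ) ^ (2 * n) = 4 ^ (n - k) * 4 ^ (n - k) * (4 ^ k) ^ 2 := by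
    rw [← pow_mul, ← pow_add, ← pow_add]; congr 1; omega
  unfold termHalf
  rw [e, div_eq_div_iff (by positivity) (by positivity)]
  calc poch (1 / 2) (n - k) * poch (1 / 2) k ^ 2 * (4 ^ (n - k) * 4 ^ (n - k) * (4 ^ k) ^ 2)
      = (poch (1 / 2) (n - k) * 4 ^ (n - k)) * (poch (1 / 2) k * 4 ^ k) ^ 2 * 4 ^ (n - k) := by ring
    _ = (((n - k).factorial : ℚ) * ((n - k).centralBinom : ℚ)) * ((k.factorial : ℚ) * (k.centralBinom : ℚ)) ^ 2
          * 4 ^ (n - k) := by rw [h1, h2]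
    _ = _ := by ring

/-- The numerator `A_n = ∑_k C(2(n−k), n−k) C(2k, k)² 4^{n−k} ∈ ℕ` with `q_n(½) = A_n / 4^{2n}`. -/
def qHalfNum (n : ℕ) : ℕ := ∑ k ∈ range (n + 1), (n - k).centralBinom * k.centralBinom ^ 2 * 4 ^ (n - k)

/-- `q_n(½) = A_n / 4^{2n}`: the reduced denominator divides `2^{4n}`. -/
theorem beukersQ_half_eq_div (n : ℕ) : beukersQ (1 / 2) n = (qHalfNum n : ℚ) / 4 ^ (2 * n) := by
  rw [beukersQ_half, qHalfNum, sum_congr rfl fun k hk => termHalf_eq n k (by simp at hk; omega)]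
  push_cast
  rw [sum_div]

/-- `den q_n(½) ∣ 2^{4n}`. -/
theorem den_beukersQ_half_dvd (n : ℕ) : (beukersQ (1 / 2) n).den ∣ 2 ^ (4 * n) := by
  have h : beukersQ (1 / 2) n = Rat.divInt (qHalfNum n : ℤ) (2 ^ (4 * n) : ℤ) := by
    rw [beukersQ_half_eq_div, Rat.divInt_eq_div]; push_cast
    rw [show (4 : ℚ) = 2 ^ 2 by norm_num, ← pow_mul, show 2 * (2 * n) = 4 * n by ring]
  have hd := Rat.den_dvd (qHalfNum n : ℤ) (2 ^ (4 * n) : ℤ)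
  rw [← h] at hd
  exact_mod_cast hd

/-- **`den q_n(½) = 2^{4n − 2 s₂(n)}` exactly** (no odd prime; the power fixed by the valuation). -/
theorem den_beukersQ_half (n : ℕ) : (beukersQ (1 / 2) n).den = 2 ^ (4 * n - 2 * sTwo n) := by
  set q := beukersQ (1 / 2) n with hq
  obtain ⟨a, ha, hden⟩ := (Nat.dvd_prime_pow Nat.prime_two).1 (den_beukersQ_half_dvd n)
  have hv := padicValRat_beukersQ_half n
  rw [← hq, padicValRat_def, hden, padicValNat.prime_pow] at hv
  have hs := sTwo_le n
  rw [← hq] at hden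
  rw [hden]
  rcases Nat.eq_zero_or_pos a with rfl | hapos
  · congr 1; omega
  · have hcop : Nat.Coprime q.num.natAbs q.den := q.reduced
    rw [hden] at hcop
    have hnd : ¬ (2 : ℤ) ∣ q.num := by
      intro h
      have h2 : 2 ∣ q.num.natAbs := by omega
      exact absurd ((Nat.Coprime.coprime_dvd_left h2 hcop).eq_one_of_dvd (dvd_pow_self 2 hapos.ne'))
        (by norm_num)
    rw [padicValInt.eq_zero_of_not_dvd hnd] at hv
    congr 1; omega

/-- Sanity by name: `v₂(q_3(½)) = −8`, `den q_3(½) = 256`. -/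
example : padicValRat 2 (beukersQ (1 / 2) 3) = -8 ∧ (beukersQ (1 / 2) 3).den = 256 := by
  rw [padicValRat_beukersQ_half, den_beukersQ_half]; simp [sTwo]

/-- **K5g (kernel form of §T Consequences (b), `q`-part).** For every `n`, Beukers' `q_n(½)` has
`2`-adic valuation `−(4n − 2 s₂(n))` and reduced denominator exactly `2^{4n − 2 s₂(n)}`. -/
theorem beukers_qHalf_denominator (n : ℕ) :
    padicValRat 2 (beukersQ (1 / 2) n) = -(4 * n : ℤ) + 2 * sTwo n ∧
      (beukersQ (1 / 2) n).den = 2 ^ (4 * n - 2 * sTwo n) :=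
  ⟨padicValRat_beukersQ_half n, den_beukersQ_half n⟩

end Summit.KontsevichZagierPeriods.Zeta5Search.CatalanBeukersDenominator
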